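import Summits.RiemannHypothesis.RiemannHypothesis.Theorems.SoloInformedGroundStatePoisson
import Summits.RiemannHypothesis.RiemannHypothesis.Theorems.SoloInformedGroundStateFamilyFourier

/-!
# Handoff (rh-explicit, prove-1), Route E: the Poisson reflection identity of the E-map

For an even Schwartz seed `h` with `h(0) = 0 = ∫ h` and a dilation `λ > 0`, the E-map image
`E_h(λ, u) = ∑_{n ≥ 1} h(nu/λ)` (Solo XII, `eMapFn`) satisfies the EXACT reflection identity

  `E_h(λ, u) = u⁻¹ · E_{U_λ h}(λ, u⁻¹)`,   `(U_λ h)(x) := λ · 𝓕h(λ² x)`   (`u > 0`),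

i.e. on the logarithmic scale `g_h(t) := e^{t/2} E_h(λ, e^t)` one has `g_h(-t) = g_{U_λ h}(t)`:
**the Weil parity `t ↦ -t` of an E-mapped test is the Fourier–dilation map `U_λ` on its seed.**
`U_λ` preserves the seed class (even, `U_λ h (0) = 0 = ∫ U_λ h`) and is an involution on even
seeds, so even seeds split into `U_λ h = ± h`, and `g_h(t) ± g_h(-t) = g_{h ± U_λ h}(t)`: the
even (odd) part of an E-mapped test is the E-map image of the `U_λ`-symmetrised
(antisymmetrised) seed.  This is Poisson summation (= the theta functional equation
`thetaRest_eq_inv_mul_thetaRest_fourier` already in the tree) read as a statement about tests;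
it is the exact identity behind the cell's «sector dictionary» (the near-null levels of the
even/odd Weil sectors follow the prolate indices `n ≡ 0 / 2 (mod 4)`, i.e. the sign `iⁿ` of the
finite Fourier transform; handoff/IDEAS-prolate §43, weil-9 PREREG-NCOUNT, handoff/prove-1
ATTEMPT-12 §5).  No zeros of ζ enter; nothing here bears on RH.

Throughout, for `hlam : 0 < λ`, the Fourier–dilation of a seed `h` is the Schwartz map
`U_λ h := (λ : ℂ) • dilateSchwartz (𝓕 h) _`, i.e. `U_λ h (x) = λ · 𝓕h(x λ²)`, and the
(unwindowed) E-mapped test is `g_h(t) := e^{t/2} E_h(λ, e^t)`; both are written out in every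
statement (this file introduces no definition).
-/

set_option linter.dupNamespace false  -- the mandated namespace repeats `RiemannHypothesis`

noncomputable section

open Complex Filter Set Topology MeasureTheory
open scoped FourierTransform
open Literature.NumberTheory.LFunctions Literature.NumberTheory.Automorphic.Meyer

namespace Summit.RiemannHypothesis.RiemannHypothesis.Theorems.HandoffRouteE

open Summit.RiemannHypothesis.RiemannHypothesis.Theorems

/-- Pointwise formula: `U_λ h (x) = λ · 𝓕h(x λ²)` [folklore]. -/
theorem fourierDilate_apply (h : SchwartzMap ℝ ℂ) {lam : ℝ} (hlam : 0 < lam) (x : ℝ) :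
    ((lam : ℂ) • dilateSchwartz (𝓕 h) (pow_ne_zero 2 hlam.ne')) x =
      (lam : ℂ) * (𝓕 h : SchwartzMap ℝ ℂ) (x * lam ^ 2) := by
  rw [smul_apply, smul_eq_mul, dilateSchwartz_apply]

/-- `U_λ h` is even when `h` is. -/
theorem fourierDilate_even (h : SchwartzMap ℝ ℂ) (heven : ∀ x, h (-x) = h x) {lam : ℝ}
    (hlam : 0 < lam) (x : ℝ) :
    ((lam : ℂ) • dilateSchwartz (𝓕 h) (pow_ne_zero 2 hlam.ne')) (-x) =
      ((lam : ℂ) • dilateSchwartz (𝓕 h) (pow_ne_zero 2 hlam.ne')) x := by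
  rw [fourierDilate_apply h hlam, fourierDilate_apply h hlam, neg_mul,
    fourier_schwartz_even h heven]

/-- `U_λ h (0) = λ ∫ h`; in particular `U_λ h (0) = 0` when `∫ h = 0`. -/
theorem fourierDilate_zero (h : SchwartzMap ℝ ℂ) {lam : ℝ} (hlam : 0 < lam)
    (hint : ∫ x : ℝ, h x = 0) :
    ((lam : ℂ) • dilateSchwartz (𝓕 h) (pow_ne_zero 2 hlam.ne')) 0 = 0 := by
  rw [fourierDilate_apply h hlam, zero_mul, SchwartzMap.fourier_coe, fourier_apply_zero, hint,
    mul_zero]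

/-- `𝓕 (𝓕 h) (x) = h (-x)` for a Schwartz map (Fourier inversion). -/
theorem fourier_fourier_apply (h : SchwartzMap ℝ ℂ) (x : ℝ) :
    (𝓕 (𝓕 h : SchwartzMap ℝ ℂ) : SchwartzMap ℝ ℂ) x = h (-x) := by
  have h1 : (𝓕 (𝓕 h : SchwartzMap ℝ ℂ) : SchwartzMap ℝ ℂ) x =
      𝓕⁻ (⇑(𝓕 h : SchwartzMap ℝ ℂ)) (-x) := by
    rw [SchwartzMap.fourier_coe, Real.fourierInv_eq_fourier_neg, neg_neg]
  rw [h1, ← SchwartzMap.fourierInv_coe, FourierTransform.fourierInv_fourier_eq]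

/-- `∫ U_λ h = λ⁻¹ h(0)`; in particular `∫ U_λ h = 0` when `h(0) = 0`. -/
theorem integral_fourierDilate (h : SchwartzMap ℝ ℂ) {lam : ℝ} (hlam : 0 < lam) (h0 : h 0 = 0) :
    ∫ x : ℝ, ((lam : ℂ) • dilateSchwartz (𝓕 h) (pow_ne_zero 2 hlam.ne')) x = 0 := by
  have hF : ∫ x : ℝ, (𝓕 h : SchwartzMap ℝ ℂ) x = h 0 := by
    rw [← fourier_apply_zero (𝓕 h : SchwartzMap ℝ ℂ), ← SchwartzMap.fourier_coe,
      fourier_fourier_apply, neg_zero]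
  have : (fun x : ℝ => ((lam : ℂ) • dilateSchwartz (𝓕 h) (pow_ne_zero 2 hlam.ne')) x) =
      fun x : ℝ => (lam : ℂ) * (fun y : ℝ => (𝓕 h : SchwartzMap ℝ ℂ) y) (x * lam ^ 2) := by
    funext x; rw [fourierDilate_apply h hlam]
  rw [this, integral_const_mul, Measure.integral_comp_mul_right _ (lam ^ 2), hF, h0, smul_zero,
    mul_zero]

/-- `U_λ` is an involution on even seeds: `U_λ (U_λ h) = h`. -/
theorem fourierDilate_fourierDilate (h : SchwartzMap ℝ ℂ) (heven : ∀ x, h (-x) = h x) {lam : ℝ}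
    (hlam : 0 < lam) :
    ((lam : ℂ) • dilateSchwartz
        (𝓕 ((lam : ℂ) • dilateSchwartz (𝓕 h) (pow_ne_zero 2 hlam.ne')))
        (pow_ne_zero 2 hlam.ne')) = h := by
  have hl : (lam : ℝ) ≠ 0 := hlam.ne'
  have hl2 : (lam ^ 2 : ℝ) ≠ 0 := by positivity
  have hlc : (lam : ℂ) ≠ 0 := by exact_mod_cast hl
  ext x
  rw [fourierDilate_apply _ hlam]
  have h1 : (𝓕 ((lam : ℂ) • dilateSchwartz (𝓕 h) (pow_ne_zero 2 hlam.ne')) : SchwartzMap ℝ ℂ)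
      (x * lam ^ 2) = (lam : ℂ)⁻¹ * h x := by
    rw [FourierTransform.fourier_smul, smul_apply, smul_eq_mul, fourier_dilateSchwartz,
      ← SchwartzMap.fourier_coe, fourier_fourier_apply, mul_div_assoc, div_self hl2, mul_one,
      show h (-x) = h x from heven x, abs_of_pos (by positivity : (0:ℝ) < (lam ^ 2)⁻¹),
      Complex.real_smul]
    push_cast
    field_simp
  rw [h1]
  field_simp

/-- Theta sums of `U_λ h`: `Θ*_{U_λ h}(y) = λ Θ*_{𝓕h}(y λ²)` (`y > 0`). -/
theorem thetaRest_fourierDilate (h : SchwartzMap ℝ ℂ) {lam : ℝ} (hlam : 0 < lam) {y : ℝ}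
    (hy : 0 < y) :
    thetaRest ((lam : ℂ) • dilateSchwartz (𝓕 h) (pow_ne_zero 2 hlam.ne')) y =
      (lam : ℂ) * thetaRest (𝓕 h) (y * lam ^ 2) := by
  have hy2 : 0 < y * lam ^ 2 := by positivity
  rw [thetaRest_eq _ hy, thetaRest_eq _ hy2, ← tsum_mul_left]
  refine tsum_congr fun n => ?_
  split_ifs with hn
  · rw [mul_zero]
  · rw [fourierDilate_apply h hlam, mul_assoc]

/-- **THE POISSON REFLECTION IDENTITY OF THE E-MAP**: for an even Schwartz seed with
`h(0) = 0 = ∫ h`, `E_h(λ, u) = u⁻¹ E_{U_λ h}(λ, u⁻¹)` for every `u > 0`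
[Poisson summation = the tree's theta functional equation
`thetaRest_eq_inv_mul_thetaRest_fourier`; cite: Meyer2005, §5.7]. -/
theorem eMapFn_reflect (h : SchwartzMap ℝ ℂ) (heven : ∀ x, h (-x) = h x) (h0 : h 0 = 0)
    (hint : ∫ x : ℝ, h x = 0) {lam : ℝ} (hlam : 0 < lam) {u : ℝ} (hu : 0 < u) :
    eMapFn h lam u =
      (u⁻¹ : ℂ) * eMapFn ((lam : ℂ) • dilateSchwartz (𝓕 h) (pow_ne_zero 2 hlam.ne')) lam u⁻¹ := by
  have hevenU := fourierDilate_even h heven hlam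
  have ht : 0 < lam⁻¹ * u := by positivity
  rw [eMapFn_eq_half_thetaRest h heven hlam hu,
    eMapFn_eq_half_thetaRest _ hevenU hlam (inv_pos.2 hu),
    thetaRest_eq_inv_mul_thetaRest_fourier h heven h0 hint ht,
    thetaRest_fourierDilate h hlam (by positivity : (0:ℝ) < lam⁻¹ * u⁻¹)]
  have e1 : (lam⁻¹ * u)⁻¹ = lam⁻¹ * u⁻¹ * lam ^ 2 := by field_simp
  rw [e1]
  push_cast
  field_simp

/-- **Weil parity = Fourier–dilation of the seed**: `g_h(-t) = g_{U_λ h}(t)`, where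
`g_k(t) = e^{t/2} E_k(λ, e^t)` is the (unwindowed) E-mapped test on the logarithmic scale. -/
theorem eMapTest_neg (h : SchwartzMap ℝ ℂ) (heven : ∀ x, h (-x) = h x) (h0 : h 0 = 0)
    (hint : ∫ x : ℝ, h x = 0) {lam : ℝ} (hlam : 0 < lam) (t : ℝ) :
    (Real.exp ((-t) / 2) : ℂ) * eMapFn h lam (Real.exp (-t)) =
      (Real.exp (t / 2) : ℂ) *
        eMapFn ((lam : ℂ) • dilateSchwartz (𝓕 h) (pow_ne_zero 2 hlam.ne')) lam (Real.exp t) := by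
  rw [eMapFn_reflect h heven h0 hint hlam (Real.exp_pos (-t)), Real.exp_neg, inv_inv]
  have hhalf : Real.exp (-t / 2) = (Real.exp (t / 2))⁻¹ * 1 := by
    rw [mul_one, ← Real.exp_neg]; ring_nf
  rw [hhalf, mul_one]
  have h2 : (Real.exp t : ℝ) = Real.exp (t / 2) * Real.exp (t / 2) := by
    rw [← Real.exp_add]; ring_nf
  have hh : (Real.exp (t / 2) : ℂ) ≠ 0 := by exact_mod_cast (Real.exp_pos (t / 2)).ne'
  rw [h2]
  push_cast
  field_simp

/-- The E-map is linear in the seed: scalar multiples. -/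
theorem eMapFn_smul (c : ℂ) (h : SchwartzMap ℝ ℂ) (lam u : ℝ) :
    eMapFn (c • h) lam u = c * eMapFn h lam u := by
  unfold eMapFn
  by_cases hu : u ∈ Ioi (0 : ℝ)
  · rw [indicator_of_mem hu, indicator_of_mem hu, ← tsum_mul_left]
    exact tsum_congr fun n => by rw [smul_apply, smul_eq_mul]
  · rw [indicator_of_notMem hu, indicator_of_notMem hu, mul_zero]

/-- The E-map is linear in the seed: sums (`λ > 0`). -/
theorem eMapFn_add (h k : SchwartzMap ℝ ℂ) {lam : ℝ} (hlam : 0 < lam) (u : ℝ) :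
    eMapFn (h + k) lam u = eMapFn h lam u + eMapFn k lam u := by
  unfold eMapFn
  by_cases hu : u ∈ Ioi (0 : ℝ)
  · rw [indicator_of_mem hu, indicator_of_mem hu, indicator_of_mem hu]
    have hx : 0 < lam⁻¹ * u := mul_pos (inv_pos.2 hlam) (mem_Ioi.1 hu)
    have hs1 := summable_schwartz_comp_nat_mul h hx
    have hs2 := summable_schwartz_comp_nat_mul k hx
    rw [← hs1.tsum_add hs2]
    exact tsum_congr fun n => by rw [add_apply]
  · rw [indicator_of_notMem hu, indicator_of_notMem hu, indicator_of_notMem hu, add_zero]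

/-- The E-map is linear in the seed: negation. -/
theorem eMapFn_neg (h : SchwartzMap ℝ ℂ) (lam u : ℝ) : eMapFn (-h) lam u = -eMapFn h lam u := by
  rw [show -h = (-1 : ℂ) • h by rw [neg_one_smul], eMapFn_smul]; ring

/-- If the seed is a `U_λ`-eigenvector, `U_λ h = ε h`, its E-mapped test has Weil parity `ε`:
`g_h(-t) = ε g_h(t)` (`ε = 1`: even test; `ε = -1`: odd test). -/
theorem eMapTest_neg_of_fourierDilate_eq (h : SchwartzMap ℝ ℂ) (heven : ∀ x, h (-x) = h x)
    (h0 : h 0 = 0) (hint : ∫ x : ℝ, h x = 0) {lam : ℝ} (hlam : 0 < lam) {ε : ℂ}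
    (hε : ((lam : ℂ) • dilateSchwartz (𝓕 h) (pow_ne_zero 2 hlam.ne')) = ε • h) (t : ℝ) :
    (Real.exp ((-t) / 2) : ℂ) * eMapFn h lam (Real.exp (-t)) =
      ε * ((Real.exp (t / 2) : ℂ) * eMapFn h lam (Real.exp t)) := by
  rw [eMapTest_neg h heven h0 hint hlam, hε, eMapFn_smul]
  ring

/-- **Symmetrisation**: the even / odd part of an E-mapped test is the E-map image of the
`U_λ`-symmetrised / antisymmetrised seed: `g_h(t) + g_h(-t) = g_{h + U_λ h}(t)` and
`g_h(t) - g_h(-t) = g_{h - U_λ h}(t)`. -/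
theorem eMapTest_add_neg (h : SchwartzMap ℝ ℂ) (heven : ∀ x, h (-x) = h x) (h0 : h 0 = 0)
    (hint : ∫ x : ℝ, h x = 0) {lam : ℝ} (hlam : 0 < lam) (t : ℝ) :
    ((Real.exp (t / 2) : ℂ) * eMapFn h lam (Real.exp t) +
        (Real.exp ((-t) / 2) : ℂ) * eMapFn h lam (Real.exp (-t)) =
      (Real.exp (t / 2) : ℂ) *
        eMapFn (h + (lam : ℂ) • dilateSchwartz (𝓕 h) (pow_ne_zero 2 hlam.ne')) lam (Real.exp t))
    ∧ ((Real.exp (t / 2) : ℂ) * eMapFn h lam (Real.exp t) -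
        (Real.exp ((-t) / 2) : ℂ) * eMapFn h lam (Real.exp (-t)) =
      (Real.exp (t / 2) : ℂ) *
        eMapFn (h - (lam : ℂ) • dilateSchwartz (𝓕 h) (pow_ne_zero 2 hlam.ne')) lam (Real.exp t)) := by
  rw [eMapTest_neg h heven h0 hint hlam]
  refine ⟨?_, ?_⟩
  · rw [eMapFn_add _ _ hlam]; ring
  · rw [sub_eq_add_neg h, eMapFn_add _ _ hlam, eMapFn_neg]; ring

end Summit.RiemannHypothesis.RiemannHypothesis.Theorems.HandoffRouteE
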